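import Mathlib
import HarnessLib
import HarnessLib.Audit
import Summits.MatrixMultiplication.Statement
import Literature.Computability.AlgebraicComplexity.MatrixMultiplicationExponent
import Summits.MatrixMultiplication.MatrixMultiplication.Theorems.BorderRankLowerBoundAssembly
import HarnessLib.Audit.Status.Attr

/-!
Route: FieldSumsetRank

DORMANT since 2026-08-22T03:26:59Z (reconciler: no traction for 5 d (last activity item-evidence-added at 2026-08-17T02:16:10Z); parked, not closed — `ledger route dormant route-MatrixMultiplication-FieldSumsetRank --off` to reactivate) — unstaffed, not closed; items shared with open routes are served there. `ledger route dormant <id> --off` reactivates.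

# Route FieldSumsetRank — rank of ⟨n,n,n⟩ is a product-set number of ℂ(t) up to a factor 2; lower
bounds by inverse sumset theorems for function fields

X (HostingSuperquadratic, the negative side): there are δ > 0 and c > 0 such that for every n ≥ 1
and every POLYNOMIAL HOSTING of n×n matrix multiplication — ℂ-linear maps α, β : M_n(ℂ) → ℂ[t] and γ
: ℂ[t] → M_n(ℂ) with γ(α(X)·β(Y)) = XY for all X, Y — the product space V₁V₂ = span{α(X)β(Y)} (V₁ =
range α, V₂ = range β, the Mathlib product of submodules) has dimension at least c·n^{2+δ}. It
realises card field-sumset-rank: the card's c_dom(n) (minimum over all fields K ⊇ ℂ) is at most the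
polynomial cost, clearing denominators shows that ℂ(t)-hostings and ℂ[t]-hostings have the same
costs, and the assembly needs only ℂ[t]. Interpolating a rank-r algorithm at r nodes gives a hosting
of cost ≤ 2r − 1 (UpperSandwich) and evaluating a hosting of cost p at p nodes gives a rank-p
algorithm (LowerSandwich), so R(⟨n,n,n⟩) ≤ cost ≤ 2R(⟨n,n,n⟩) − 1: X is the superquadratic-rank
thesis FThesis of route BorderRankLowerBound (stmt-MatrixMultiplication-0652) rewritten, losslessly
up to a factor 2, as an extremal problem of additive combinatorics in the function field ℂ(t): how
small can the product of two n²-dimensional spaces of rational functions be when all its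
product-syzygies are matrix syzygies.
Lean: `∃ δ : ℝ, 0 < δ ∧ ∃ c : ℝ, 0 < c ∧ ∀ n : ℕ, 1 ≤ n → ∀ (α β : Matrix (Fin n) (Fin n) ℂ →ₗ[ℂ]
Polynomial ℂ) (γ : Polynomial ℂ →ₗ[ℂ] Matrix (Fin n) (Fin n) ℂ), (∀ X Y, γ (α X * β Y) = X * Y) → c
* (n : ℝ) ^ (2 + δ) ≤ (Module.finrank ℂ ↥(LinearMap.range α * LinearMap.range β) : ℝ)`

## Assembly
Pure logic plus one theorem already in the tree: given X and UpperSandwich, fix n ≥ 1 and r =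
R(⟨n,n,n⟩); UpperSandwich yields a hosting of cost ≤ 2r − 1 < 2r and X bounds that cost below by
c·n^{2+δ}, so (c/2)·n^{2+δ} ≤ R(⟨n,n,n⟩) for all n ≥ 1 — exactly the hypothesis of the PROVED
assembly of route BorderRankLowerBound
(`Literature.not_matrixMultiplication_of_superquadratic_rank`,
Theorems/BorderRankLowerBoundAssembly.lean, stmt-0653), which gives ¬(ω(ℂ) = 2). The cruxes at ranks
2–4 are rungs (n = 2; the 3k−4 window; constant doubling 6) calibrating the language and do not
enter the implication; by the same three lines HostingBeatsSix ∧ UpperSandwich → FBeatThreeNSquared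
(stmt-0654) and ThreeKMinusFourRung ∧ UpperSandwich → R(⟨n,n,n⟩) ≥ (3n² − 2)/2.

Rationale: WHY THIS LINE. Mechanism: lower bounds for R(⟨n,n,n⟩) become CLASSIFICATION theorems for pairs of
subspaces of ℂ(t) with small product — Kneser's theorem for field extensions (HouLeungXiang2002,
BachocSerraZemor2018Kneser), the Vosper analogue (BachocSerraZemor2017), the function-field Freiman
3k−4 theorem, now PROVED for squares (CouvreurZemor2024 = arXiv:2408.00183 Thm 1; conjectured in
BachocCouvreurZemor2018, rational-field cases arXiv:2405.10724) — followed by a rigidity step saying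
that the classified pairs (dilated geometric progressions y·{1,u,…,u^{a−1}}, nodal/cuspidal
hyperplanes in them, Riemann–Roch-type spaces) cannot carry matrix multiplication, which is geometry
of Hankel forms and rational normal curves (IarrobinoKanev1999) or, through evaluation at nodes, the
statement that the two coefficient codes of a bilinear algorithm for ⟨n,n,n⟩ cannot both sit inside
low-dimensional generalised Reed–Solomon codes (the codes-from-algorithms dictionary of
BrockettDobkin1978, doi:10.1137/0218052, arXiv:1312.0022, arXiv:1501.06419, used there with counting
bounds that are void over ℂ). Imported areas: additive combinatorics of field extensions and
algebraic-geometry codes; nothing probabilistic or spectral is used. What it does that prior routes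
and the negatives index (empty) do not: BorderRankLowerBound bounds R by equations of secant
varieties, a class capped at 6n² − 4 / 8n² by LinearRankMethodBarrier; here the bounded quantity is
the cost, defined by the HOST ℂ(t), and its lower bounds are structure theorems (stabiliser
subfields, valuations, Riemann–Roch), transferred to R only at the end through cost ≤ 2R − 1. New at
open (planner's hand computation, NOTES.md): the card's conjecture cost(2) = 13 is false —
Strassen's seven X-forms and seven Y-forms each admit a nowhere-zero linear dependency, so they fit
into generalised Reed–Solomon codes of dimension 6 on 7 nodes and give a hosting of cost ≤ 11 = 2R −
3 (StrassenHostingEleven), while dimension 5 is impossible when a rank-7 algorithm is interpolated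
at distinct nodes (two coordinates of every dependency coincide; DeGroote1978 makes this independent
of the rank-7 algorithm chosen), so anything cheaper than 11 must interpolate a longer, non-minimal
algorithm or use confluent nodes; with Kneser–Vosper and the card's Lemma A, cost(2) ≥ 8, and the n
= 2 rung is filed as cost(2) ≥ 9. Since open (route review by refuter-rreview-0815T13-3-0 and
refuter g40-63, 2026-08-15; evidence on the route and on stmt-8735/8740): an EXPLICIT HOSTING OF
COST 9 of ⟨2,2,2⟩ — α(X) = X₀₀ + X₀₁t + X₁₀t² + X₁₁t³ (V₁ = Prog₄(t)), β(Y) = Y₁₀ + Y₀₀t + Y₁₁t⁴ +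
Y₀₁t⁵ (V₂ = ⟨1,t⟩·⟨1,t⁴⟩), γ = the odd coefficients ((XY)₀₀, (XY)₀₁, (XY)₁₀, (XY)₁₁ = coefficients
of t, t⁵, t³, t⁷), V₁V₂ = ℂ[t]_{<9} (HostingNine.lean, lean rc 0, attached to stmt-8740; it proves
StrassenHostingEleven a fortiori) — so cost(2) ∈ {8, 9}: a genuinely curve-shaped way to multiply
2×2 matrices two below the GRS value 11, of exactly the 'longer algorithm (rank 9) on one rational
curve' kind foreseen at open, and TwoByTwoHostingNine now decides cost(2); the engines Kneser /
linear Cauchy–Davenport / Vosper for field extensions are PROVED Literature theorems as of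
2026-08-15 (Literature.Combinatorics.Additive.LinearKneser_holds, LinearCauchyDavenport_holds,
LinearVosperAlgClosed_holds) and enter no item as a hypothesis.

RANKED CRUXES. #0 HostingSuperquadratic (target) — X of the Thesis: some δ > 0, c > 0 make every
polynomial hosting (α, β, γ) of ⟨n,n,n⟩, n ≥ 1, satisfy dim(range α · range β) ≥ c·n^{2+δ} (card K1:
the inverse theorem with syzygy constraint, in its lower-bound form). [deps: UpperSandwich]
[difficulty: open-problem] (why it might fail: Equivalent up to a factor 2 to FThesis R(⟨n,n,n⟩) ≥
c·n^{2+δ} (stmt-0652), believed false by the ω = 2 camp; if true it needs inverse structure at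
doubling n^δ → ∞, where no Freiman-type theorem exists even over ℤ (PFR is constant doubling).)
[Landsberg2014, BachocCouvreurZemor2018, CouvreurZemor2024, Blaser2013]
#2 TwoByTwoHostingNine (crux) — Every polynomial hosting of ⟨2,2,2⟩ costs at least 9 (card K3; TIGHT
if true — the explicit cost-9 hosting on stmt-8740 makes this item decide cost(2) ∈ {8, 9}): the
pairs (V₁, V₂) of 4-dimensional subspaces of ℂ(t) with dim V₁V₂ = 8 — one step above the Vosper
boundary 7; expected types up to dilation and a common variable u ∈ ℂ(t): (Prog₄(u), a hyperplane of
Prog₅(u)) and two hyperplanes of Prog₅(u) of nodal type {f(a) = λ f(b)} or cuspidal type with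
matching node (pair version of the γ = 1, genus-0 classification BachocCouvreurZemor2018 Thm 8.1) —
do not host 2×2 matrix multiplication; in code language (evaluation at distinct nodes): no length-8
(resp. 9) bilinear algorithm for ⟨2,2,2⟩ has both coefficient codes inside the corresponding
generalised Reed–Solomon (sub)codes. [deps: TwoByTwoHostingEight] [difficulty: M] (why it might
fail: A length-8 algorithm for ⟨2,2,2⟩ whose coefficient codes are an [8,4] Reed–Solomon code and a
subcode of an [8,5] GRS code (or two nodal-type subcodes of [9,5] GRS codes) is a cost-8 hosting;
the count, 32 bilinear equations against about 25 effective unknowns, is only mildly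
overdetermined.) [BachocCouvreurZemor2018, BachocSerraZemor2017, DeGroote1978, arXiv:2405.10724,
HopcroftKerr1971]
#3 ThreeKMinusFourRung (crux) — For every n ≥ 2 every polynomial hosting of ⟨n,n,n⟩ costs at least
3n² − 3, i.e. the whole Freiman window dim V₁V₂ ≤ dim V₁ + dim V₂ + n² − 4 contains no hosting (card
K2): (i) a PAIR version inside ℂ(t) of the function-field 3k−4 theorem (CouvreurZemor2024 Thm 1 is
the square case: combinatorial genus γ ≤ dim S − 3 forces transcendence degree 1, genus g ≤ γ and S
of codimension ≤ γ − g in a Riemann–Roch space; inside ℂ(t) every subfield is rational, g = 0)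
placing V₁, V₂ in dilated progressions y_i·Prog(u) with total codimension ≤ γ; (ii) HANKEL RIGIDITY:
sub-pairs of (Prog_a(u), Prog_b(u)) with a + b − 1 ≤ 3n² − 4 host no ⟨n,n,n⟩ (the card's Lemma A is
n = 2, a = b = 4, γ = 0). Through UpperSandwich it only returns R ≥ 1.5n²; its value is to validate
tools (i)–(ii) where the inverse theorem is printed. [deps: TwoByTwoHostingNine] [difficulty: L]
(why it might fail: (i) the 3k−4 theorem is proved for squares only (CouvreurZemor2024), pairs S ≠ T
are open; (ii) needs rigidity for codimension-γ sub-pairs of progressions up to γ = n² − 3, far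
beyond Lemma A (γ = 0); at n = 3 it asserts cost ≥ 24 while R(⟨3,3,3⟩) ∈ [19, 23].)
[CouvreurZemor2024, BachocCouvreurZemor2018, arXiv:2405.10724, Landsberg2014, MassarentiRaviolo2013,
Blaser2003]
#4 HostingBeatsSix (crux) — There is c > 6 such that for all large n every polynomial hosting of
⟨n,n,n⟩ costs at least c·n². With UpperSandwich (cost ≤ 2R − 1) this gives R(⟨n,n,n⟩) > (c/2)·n² >
3n² eventually, i.e. FBeatThreeNSquared of route BorderRankLowerBound (stmt-0654): the first
statement of the new language that beats the 3n² − o(n²) record. It lives at constant doubling ≤ 6 —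
the regime of Freiman's theorem over ℤ — and asks for a function-field Freiman theorem (structure of
n²-dimensional pairs with dim V₁V₂ < 6n²) plus rigidity of the structured pairs. [deps:
ThreeKMinusFourRung] [difficulty: open-problem] (why it might fail: No inverse theorem at doubling ≥
3 exists in any field extension (CouvreurZemor2024 stops at 3k−4), and hosts of transcendence degree
2 (products of progressions, doubling 4) appear; false iff cost < (6+o(1))n² infinitely often, which
forces R(⟨n,n,n⟩) < (6+o(1))n² i.o. — open either way.) [Landsberg2014, MassarentiRaviolo2013,
CouvreurZemor2024, EfremenkoGargOliveiraWigderson2018, Buczynski2026]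
#9 UpperSandwich (support) — If R(⟨n,n,n⟩) ≤ r then ⟨n,n,n⟩ has a polynomial hosting of cost ≤ 2r −
1: from XY = Σ_{i≤r} a_i(X) b_i(Y) C_i (unpack tensorRank as a sum of r triads, Nat.sInf_mem) take r
distinct nodes t_i with Lagrange basis ℓ_i of ℂ[t]_{<r}, α(X) = Σ a_i(X)ℓ_i, β(Y) = Σ b_i(Y)ℓ_i, γ =
Σ_i C_i·ev_{t_i}; then γ(α(X)β(Y)) = XY and range α · range β ⊆ ℂ[t]_{≤2r−2} (Polynomial.degreeLT);
r = 0 forces n = 0 or is vacuous. [difficulty: provable-now] [Blaser2013,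
BurgisserClausenShokrollahi1997]
#9 LowerSandwich (support) — A polynomial hosting of cost p yields a rank-p bilinear algorithm, so
R(⟨n,n,n⟩) ≤ dim(range α · range β): choose p nodes on which the p-dimensional space W = V₁V₂ ⊂ ℂ[t]
is interpolating (evaluation functionals span W^*, pick a basis), write w = Σ_k w(t_k) ω_k on W, and
read XY = γ(α(X)β(Y)) = Σ_k α(X)(t_k)·β(Y)(t_k)·γ(ω_k) as p triads (tensorRank_le_of_eq_sum).
[difficulty: provable-now] [Blaser2013, BurgisserClausenShokrollahi1997, BrockettDobkin1978]
#9 StrassenHostingEleven (support) — ⟨2,2,2⟩ has a polynomial hosting of cost ≤ 11 (so cost(2) ≤ 11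
< 13 = 2R − 1): with Strassen's algorithm XY = Σ_{i≤7} a_i(X) b_i(Y) C_i (a = (x11+x22, x21+x22,
x11, x22, x11+x12, x21−x11, x12−x22), b = (y11+y22, y11, y12−y22, y21−y11, y22, y11+y12, y21+y22), C
= (E11+E22, E21−E22, E12+E22, E11+E21, E12−E11, E22, E11)), the nowhere-zero dependencies u =
(1,1,−3,−3,1,−1,−1) (Σ u_i a_i = 0) and u' = (1,1,1,1,1,−1,−1) (Σ u'_i b_i = 0), seven distinct
nodes t_i, w_i = Π_{j≠i}(t_i − t_j)^{-1}, y_i = u_i/w_i, z_i = u'_i/w_i: α(X) = the unique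
polynomial of degree ≤ 5 interpolating (t_i, y_i a_i(X)) (the seven conditions are consistent
because (w_i y_i) annihilates A), β(Y) likewise from (t_i, z_i b_i(Y)), γ = Σ_i (y_i z_i)^{-1}
C_i·ev_{t_i}; then γ(α(X)β(Y)) = XY and range α · range β ⊆ ℂ[t]_{≤10}. [difficulty: provable-now]
[DeGroote1978, Blaser2013, HopcroftKerr1971]
#9 TwoByTwoHostingEight (support) — Every polynomial hosting of ⟨2,2,2⟩ costs at least 8 (card Lemma
A + pair-Vosper): α, β are injective, Kneser's theorem for the extension ℂ(t)/ℂ gives dim V₁V₂ ≥ 4 +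
4 − 1 (ℂ is algebraically closed in ℂ(t), so the stabiliser field of V₁V₂ is ℂ), the Vosper analogue
makes a cost-7 pair a pair of dilated progressions y₁·Prog₄(u), y₂·Prog₄(u), i.e. the host map is
4×4 → 7 polynomial multiplication, and Lemma A excludes it: the pencil Z = e₁wᵀ gives a projective
line of rank-2 bilinear forms (X,Y) ↦ tr(ZXY) with no rank-1 point, whereas 4×4 Hankel forms of rank
≤ 2 form the cone over σ₂ of the rational normal sextic and every line in σ₂(C₆) meets C₆ (any 7
points of C₆ are independent). [difficulty: M] [BachocSerraZemor2017, BachocSerraZemor2018Kneser,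
BachocCouvreurZemor2018, IarrobinoKanev1999, HopcroftKerr1971]

TWO-LAYER PLAN. Foreseen glued splits (none filed now; k ≤ 3, depth 1): TwoByTwoHostingNine ⇐
PairVosperPlusOne (classification of 4-dimensional pairs in ℂ(t) with dim V₁V₂ = 8: progression ×
hyperplane, nodal/cuspidal hyperplane pairs) → NoHostingProgFourFive → NoHostingNodalPair →
TwoByTwoHostingNine; ThreeKMinusFourRung ⇐ PairThreeKMinusFour (pairs in ℂ(t) with dim V₁V₂ ≤ dim V₁
+ dim V₂ + min − 4 sit with total codimension ≤ γ in dilated progressions y_i·Prog(u); `V ≤ y • Prog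
a u` is typable over RatFunc ℂ) → HankelRigidity (sub-pairs of (Prog_a, Prog_b) with a + b − 1 ≤ 3n²
− 4 host no ⟨n,n,n⟩) → ThreeKMinusFourRung; HostingSuperquadratic ⇐ FunctionFieldFreiman (structure
of n²-dimensional pairs of ℂ(t) with dim V₁V₂ ≤ n^{2+δ}: covered by n^{O(δ)} dilated progressions /
low-degree images — to be made precise only after rungs 2–3) → StructuredPairRigidity →
HostingSuperquadratic. Helper lemmas provers will need and attach with --supports: the syzygy
criterion (γ exists iff ker(mult on V₁⊗V₂) ⊆ (α⊗β)(ker of matrix multiplication)), the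
evaluation/GRS dictionary (cost = dim of the coordinatewise product A⋆B of the two coefficient
codes), the symmetric-pair bound on dim(V₁ ∩ V₂) (card P3).

KILL CRITERIA. Outright: any positive route proving ω(ℂ) = 2 refutes HostingSuperquadratic (via
LowerSandwich-free logic: X ∧ UpperSandwich ⇒ ω ≥ 2 + δ) — close `refuted:HostingSuperquadratic`.
Rung refutations do not close the route but re-price it: an explicit cost-8 hosting of ⟨2,2,2⟩
refutes TwoByTwoHostingNine → restate the n = 2 rung as the exact value cost(2) = 8 (support item
StrassenHostingEleven caps it at 11, the review's explicit hosting at 9); a hosting of cost ≤ 3n² −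
4 for some n refutes ThreeKMinusFourRung → drop it and keep HostingBeatsSix; if such refuting
hostings come in a PATTERN that scales (cost ≤ R(⟨n,n,n⟩) + o(n²) for all n, i.e. ℂ(t) is
asymptotically as cheap as the split algebra ℂ^R), the language has no lower-bound content beyond R
≤ cost and the route is closed `refuted:` with that census. A counterexample to the PAIR 3k−4
statement in ℂ(t) (small product, not inside progressions) removes engine (i) of ThreeKMinusFourRung
→ pivot that rung to direct Hankel/GRS rigidity. FThesis (0652) proved by BorderRankLowerBound's own
means moots the route (superseded).

NOT DECOMPOSED YET. cost(2) ∈ {8, 9} is now decided by TwoByTwoHostingNine itself; a BORDER version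
at n = 2, suggested by the review's numerics — `BorderCostTwoLeEight`: ⟨2,2,2⟩ lies in the closure
of the set of bilinear maps hosted at cost ≤ 8 (fixed-pair alternating least squares over ~90
pairs/charts found no exact cost-8 hosting anywhere, but on the single pair (Prog₅ = ℂ[t]_{<5},
⟨1,t,t³,t⁴⟩ = ⟨1,t⟩·⟨1,t³⟩), whose product is ℂ[t]_{<8}, the residual tends to 0 only as det α, det
β → 0: an approximate hosting by degeneration; TwoByTwoHostingNine-analysis-v2.md on stmt-8735) — to
be filed as a support item by the tenure planner once TwoByTwoHostingNine is settled, since cost(2)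
= 9 with border-cost(2) ≤ 8 would be the n = 2 instance, inside the new language, of a
rank/border-rank gap, and the border quantity is the one that meets LandsbergMichalek2018; the
all-fields quantity c_dom(n) of the card (elliptic and higher-genus hosts; needs a
Nullstellensatz-based LowerSandwich and genus bookkeeping Mathlib lacks) — a strengthening, not
needed by the assembly; the pair versions of Vosper+1 and of the 3k−4 theorem as stand-alone
statements (layer-2 children above); a border/degeneration version of cost (closure of the set of
hostings), which would transfer to bR(⟨n,n,n⟩) ≥ cost/2 and meet LandsbergMichalek2018; constants in
HostingBeatsSix (any c > 6 will do; 6 = 2·3 is where the transfer beats Landsberg2014); n = 3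
numerics (cost(3) ∈ [19, 45]).

CHEAPEST FALSIFIER. A computer-algebra search (refuter kit job: Gröbner basis or numerical algebraic
geometry) for a cost-8 hosting of ⟨2,2,2⟩ inside the two expected pair types — (Prog₄(u), hyperplane
G ⊂ Prog₅(u)): G ∈ P⁴, 4 parameters; nodal/cuspidal hyperplane pairs {f(a) = λ₁f(b)}, {g(a) =
λ₂g(b)}: 2 parameters after PGL₂ — solving g₁·(M₂ ⊗ I₂)·g₂ ⊆ ℋ(V₁,V₂) (ℋ = the 8-dimensional space
of 4×4 matrices P·Hankel·Qᵀ; 32 bilinear equations, 32 unknowns, an 11-dimensional stabiliser): a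
solution refutes TwoByTwoHostingNine at once. Status 2026-08-15 (route review): cost 9 is ATTAINED
(HostingNine.lean on stmt-8740), so the falsifier is exactly 'find a cost-8 hosting'; by the
review's structure lemma (given α, β, a γ exists iff ker Φ ⊆ ker(X ⊗ Y ↦ XY) for Φ = mult ∘ (α ⊗ β)
: M₂ ⊗ M₂ → ℂ[t], and then cost = rank Φ) it is a 32 × 16 rank-drop problem per candidate pair (V₁,
V₂) with dim V₁V₂ = 8; sandwich (rank-1) and monomial hostings provably have cost ≥ 9 (Kneser /
exhaustive exponent search); a complex Levenberg–Marquardt search on the full system γ(α(X)β(Y)) =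
XY by degree shape (refuter g40-63, mm/host_search.py, 40 restarts per shape, validated on the
shapes where solutions must exist) finds NO solution in the cost-8 Riemann–Roch shape (3,4) (best
residual 1.2e-3), exact rank-9 families in shapes (3,5) and (4,4), rank 10 in (4,5), 11 in (5,5), 13
in (6,6) (kit j001281, j001282–4; notes and TwoByTwoHostingNine-analysis(-v2).md on stmt-8735);
heuristic count behind 'cost(2) = 9': rank-8 decompositions of ⟨2,2,2⟩ have 8·10 − 64 − 10 = 6
moduli while lying on rational curves of degrees (3,4) with common parameters costs codimension 4 +
5 = 9 > 6, whereas rank 9 gives 16 moduli against 10 conditions — positive-dimensional families, as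
observed; special loci of the rank-8 variety are not excluded, so this is evidence, not proof. Run
by hand at open (NOTES.md of the opening planner): cost 7 is impossible (Lemma A, refuter-verified
on the card; independently: Winograd's optimality of evaluation–interpolation for full polynomial
products plus DeGroote1978 — Strassen's a-points x₁₁+x₂₂, x₁₁, x₂₂ are collinear, impossible for 7
points of a twisted cubic), cost 11 is attained by GRS₆ containment of Strassen's coefficient codes
(StrassenHostingEleven), GRS₅ containment is impossible for every rank-7 algorithm at distinct nodes
(coordinates 3,4 of A^⊥ = {(λ, μ, −λ−μ−ν, −λ−μ−ν, ν, −μ, −ν)} coincide, DeGroote1978 transports this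
to all rank-7 algorithms), so interpolating a minimal algorithm gives exactly 11 on P¹ and anything
cheaper must come from a longer algorithm or confluent nodes.

NUMBERS. R(⟨2,2,2⟩) = bR(⟨2,2,2⟩) = 7 (Strassen 1969; HopcroftKerr1971; Landsberg 2006); cost(2) ∈
[8, 9] (TwoByTwoHostingEight; the review's explicit cost-9 hosting HostingNine.lean on stmt-8740,
which also settles StrassenHostingEleven), the sandwich alone allows [7, 13]; UpperSandwich and
LowerSandwich have candidate proofs attached (UpperSandwich.lean on stmt-8738, LowerSandwich on
stmt-8739, lean rc 0, review addendum), making R ≤ cost ≤ 2R − 1 formal once landed under Theorems/,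
and HostingSuperquadratic ⟺ FThesis (stmt-0652) is written out in TargetEquivalence.lean on
stmt-8734; R(⟨3,3,3⟩) ∈ [19, 23] (Blaser2003; Laderman), so cost(3) ∈ [19, 45] and
ThreeKMinusFourRung claims ≥ 24; R(⟨n,n,n⟩) ≥ 3n² − O(n^{3/2}) (Landsberg2014;
MassarentiRaviolo2013: 3n² − 2√2·n^{3/2} − 3n); bR(⟨n,n,n⟩) ≥ 2n² − ⌈log₂ n⌉ − 1
(LandsbergMichalek2018); rank-method ceilings 8n² (EfremenkoGargOliveiraWigderson2018 Thm 4.4) and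
6n² − 4 (Buczynski2026) — cost > 12n² resp. > 16n² + O(1) is where the transfer cost ≤ 2R − 1 would
pass them. Inverse theorems in an extension F/K, K algebraically closed in F: dim ST ≥ dim S + dim T
− dim Stab(ST) (HouLeungXiang2002; BachocSerraZemor2018Kneser without separability); dim ST = dim S
+ dim T − 1 ⇒ geometric-progression bases (BachocSerraZemor2017, pairs, K algebraically closed: Thm
34 p. 16 as page-read by the card's refuter); dim S² = 2 dim S − 1 + γ, γ ≤ dim S − 3 ⇒ trdeg 1,
genus ≤ γ, S of codimension ≤ γ − g in some L(D) (CouvreurZemor2024 Thm 1, p. 3 read; γ ≤ 1 and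
genus-0 explicit bases BachocCouvreurZemor2018 Thm 5.3 / 8.1; γ = 2 in K(x) arXiv:2405.10724 Thm
1.6–1.7). General slack: every minimal algorithm has each X-form in the span of the others (else Y ↦
X₀Y would have rank 1), hence nowhere-zero dependencies and cost(n) ≤ 2R(⟨n,n,n⟩) − 3 for n ≥ 2.
Items: 9 (1 target, 3 cruxes, 4 support, 1 assembly), unchanged since open.

DEFINITION REQUESTS. None at open: hosting and cost are inlined over Mathlib (`LinearMap.range α *
LinearMap.range β` is `Submodule.mul` in the ℂ-algebra `Polynomial ℂ`; `Module.finrank`), and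
`tensorRank` / `matMulTensor` exist (Literature.Computability.AlgebraicComplexity). If a second
route adopts the language: `hostingCost n : ℕ` (minimum cost over polynomial hostings, topic
Literature/Computability/AlgebraicComplexity) and `IsDilatedProgression (V : Submodule ℂ (RatFunc
ℂ))`. Engines now in tree as PROVED Literature theorems (no debt; usable outright by provers of the
rungs): Kneser's theorem for field extensions `Literature.Combinatorics.Additive.LinearKneser_holds`
(HouLeungXiang2002 / BachocSerraZemor2018Kneser), the linear Cauchy–Davenport inequality
`Literature.Combinatorics.Additive.LinearCauchyDavenport_holds` (BachocSerraZemor2017 Thm 2) and the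
Vosper analogue over an algebraically closed base
`Literature.Combinatorics.Additive.LinearVosperAlgClosed_holds` (BachocSerraZemor2017 Thm 34), all
landed 2026-08-15; still unvendored: CouvreurZemor2024 Thm 1 (Riemann–Roch spaces L(D) of function
fields are absent from Mathlib — DEF-REQUEST noted on stmt-8736 by the grounder), needed only from
rung 3 on; for n = 2 everything can also be done by direct computation with 4-dimensional spaces of
rational functions.

Novelty: Searches (2026-08-15): `lit search --source zbmath "Kneser field extensions"` (15:
BachocSerraZemor2018Kneser, Hou 2007 vector-space Kneser, cogalois noise); `… "Couvreur Zémor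
Freiman"` (3: arXiv:2408.00183 = CouvreurZemor2024 — the 3k−4 theorem for function fields, PROVED
2024, not on the card; arXiv:1709.00087; arXiv:2405.10724), both read (Thm 1 p. 3 and §6 of
2408.00183; Conj 1.3/Thm 1.4 p. 2 of 2405.10724); `… "Zémor field extension products subspaces"` (2:
arXiv:1501.00602, arXiv:1510.01354); `… "Bshouty lower bound matrix multiplication codes"` (1
relevant: doi:10.1137/0218052); `… "lower bounds multiplicative complexity linear codes bilinear
algorithms"` (BurgisserClausenShokrollahi1997 only); `… "critical pairs Schur product codes
Vosper"`, `… "small sumsets function fields combinatorial genus"`, `… "small products of subspaces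
in field extensions Freiman 3k-4"` (0 each); `lit galaxy search "small sumsets in field extensions"
--star all` (0), `"linear codes and bilinear algorithms" --star all` (0), `--star pdf --mode
intelligent "lower bounds on bilinear complexity / tensor rank from linear codes, Reed–Solomon
codes, Cauchy–Davenport/Kneser/Vosper/Freiman in field extensions"` (15 rows, none joining the two
sides: Strassen's ISSAC 2012 asymptotic-spectrum talk, Briët–Christandl–Leigh–Shpilka–Zuiddam ITCS
2024, coding-theory surveys); local searchd down (rc 75), OpenAlex/S2 rate-limited (429) — logged;
`ledger negatives --problem MatrixMultiplication` (0); grep of th  [refs: 10.1137/0218052, 2408.00183, 1709.00087, 2405.10724, 1501.00602, 1510.01354, 2410.14905, 1312.0022, 1501.06419, doi:10.1137/0218052, arxiv:2410.14905, CouvreurZemor2024, BurgisserClausenShokrollahi1997, BlasiakCohnGrochowPrattUmans2025, BachocCouvreurZemor2018, BachocSerraZemor2017, BrockettDobkin1978]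

Barriers (technique_class: rank-lower-bound, sumsets-in-function-fields): - technique_class: rank-lower-bound, sumsets-in-function-fields
- Literature.Barriers.MatrixMultiplication.LinearRankMethodBarrier: the catalogued caps
(Buczynski2026_cactusBarrier_segre.matMul: linear rank methods certify ≤ 6n² − 4; EGOW2018_thm44:
rank methods ≤ 8n²) price functionals/determinantal equations evaluated on ⟨n,n,n⟩; this line never
exhibits one — a cost lower bound is a classification of small-product pairs in ℂ(t) (stabiliser
subfields, valuations, Riemann–Roch: CouvreurZemor2024) plus rigidity of the classified hosts,
transferred to R by cost ≤ 2R − 1, so formally it is outside the class. Conceded: the rigidity steps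
written so far (Lemma A) use catalecticant geometry of the HOST's Hankel forms, every rung filed (≤
3n² − 3, > 6n²) transfers to R-bounds inside the 8n² window anyway, and no cost bound beyond R + 1
is proved yet; the bet is that structure theorems for the host, not equations for the tensor, carry
the superquadratic regime.
- Literature.Barriers.MatrixMultiplication.InfimumNotMinimumBarrier: not applicable — negative side;
the sandwich is per n and X is an eventual lower bound, no limit is exchanged with a minimum.
- Literature.Barriers.MatrixMultiplication.IrreversibilityBarrier: not applicable — no intermediate
tensor or degeneration is used (likewise UniversalMethodBarrier, UnstableTensorBarrier,
RectangularBarrier and the group-theoretic entries TricoloredSumFree / NilpotentGroup / Normalizer /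
Quasirandom / YoungSubgroup / Equivoluminous: u

History (route lifecycle, newest last):
- 2026-08-15T16:36:40Z · rev 2: restated Assembly (stmt-MatrixMultiplication-8742) — route-repair (cone, gen 2), follow-up to rev 1: (i) restate Assembly cosmetically (¬ _root_.MatrixMultiplication — same Prop) so the whole file is re-typechecke (planner-rrepair-MatrixMultiplication-FieldSums-3ef2757d-g2-0)
- 2026-08-16T04:10:46Z · AUTO-CRUX (backfill): HostingSuperquadratic — hypotheses of the deciding theorem that nothing in the route derives are cruxes (operator:999:1085951)
- 2026-08-22T03:26:59Z · DORMANT — reconciler: no traction for 5 d (last activity item-evidence-added at 2026-08-17T02:16:10Z); parked, not closed — `ledger route dormant route-MatrixMultiplicati (operator:999:267036)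

sub-problem: MatrixMultiplication · status: dormant · opened planner-plancard-MatrixMultiplication-MatrixM-34be9f02-0 2026-08-15T13:29:18Z · rev 3 · ledger route-MatrixMultiplication-FieldSumsetRank
GENERATED by the gate from the ledger (D-0016/17). Provers cite these decls: `theorem foo : Summit.MatrixMultiplication.MatrixMultiplication.Theses.FieldSumsetRank.<Decl> := …` in Summits/MatrixMultiplication/MatrixMultiplication/Theorems/<Name>.lean.
-/

namespace Summit.MatrixMultiplication.MatrixMultiplication.Theses.FieldSumsetRank

open scoped BigOperators Topology Manifold Classical MeasureTheory ProbabilityTheory Matrix InnerProductSpace ComplexConjugate ContinuousMap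
open Filter Set Function TopologicalSpace MeasureTheory

attribute [summit_statement] _root_.MatrixMultiplication

/-- item stmt-MatrixMultiplication-8734 · crux (kind.auto-crux: conjecture-grade) · rank 0 · open · by planner
why it might fail: Equivalent up to a factor 2 to FThesis R(⟨n,n,n⟩) ≥ c·n^{2+δ} (stmt-0652), believed false by the ω = 2 camp; if true it needs inverse structure at doubling n^δ → ∞, where no Freiman-type theorem exists even over ℤ (PFR is constant doubling).
sources: Landsberg2014, BachocCouvreurZemor2018, CouvreurZemor2024, Blaser2013
[target] X of the Thesis: some δ > 0, c > 0 make every polynomial hosting (α, β, γ) of ⟨n,n,n⟩, n ≥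
1, satisfy dim(range α · range β) ≥ c·n^{2+δ} (card K1: the inverse theorem with syzygy constraint,
in its lower-bound form). [deps: UpperSandwich] [difficulty: open-problem] -/
@[route_item "route-MatrixMultiplication-FieldSumsetRank", crux]
def HostingSuperquadratic : Prop :=
  ∃ δ : ℝ, 0 < δ ∧ ∃ c : ℝ, 0 < c ∧ ∀ n : ℕ, 1 ≤ n → ∀ (α β : Matrix (Fin n) (Fin n) ℂ →ₗ[ℂ] Polynomial ℂ) (γ : Polynomial ℂ →ₗ[ℂ] Matrix (Fin n) (Fin n) ℂ), (∀ X Y, γ (α X * β Y) = X * Y) → c * (n : ℝ) ^ (2 + δ) ≤ (Module.finrank ℂ ↥(LinearMap.range α * LinearMap.range β) : ℝ)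

/-- item stmt-MatrixMultiplication-8735 · crux · rank 2 · open · by planner
why it might fail: A cost-8 hosting of ⟨2,2,2⟩ refutes it; cost 9 is attained (HostingNine.lean, stmt-8740), so it is tight if true: 32 bilinear equations vs ~25 effective unknowns per candidate pair, only mildly overdetermined; LM numerics found none in shape (3,4), special loci of the rank-8 variety not excluded.
sources: BachocCouvreurZemor2018, BachocSerraZemor2017, DeGroote1978, arXiv:2405.10724, HopcroftKerr1971
[crux] Every polynomial hosting of ⟨2,2,2⟩ costs at least 9 (card K3, sharpened by cost(2) ≤ 11):
the pairs (V₁, V₂) of 4-dimensional subspaces of ℂ(t) with dim V₁V₂ = 8 — one step above the Vosper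
boundary 7; expected types up to dilation and a common variable u ∈ ℂ(t): (Prog₄(u), a hyperplane of
Prog₅(u)) and two hyperplanes of Prog₅(u) of nodal type {f(a) = λ f(b)} or cuspidal type with
matching node (pair version of the γ = 1, genus-0 classification BachocCouvreurZemor2018 Thm 8.1) —
do not host 2×2 matrix multiplication; in code language (evaluation at distinct nodes): no length-8
(resp. 9) bilinear algorithm for ⟨2,2,2⟩ has both coefficient codes inside the corresponding
generalised Reed–Solomon (sub)codes. [deps: TwoByTwoHostingEight] [difficulty: M] -/
@[route_item "route-MatrixMultiplication-FieldSumsetRank"]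
def TwoByTwoHostingNine : Prop :=
  ∀ (α β : Matrix (Fin 2) (Fin 2) ℂ →ₗ[ℂ] Polynomial ℂ) (γ : Polynomial ℂ →ₗ[ℂ] Matrix (Fin 2) (Fin 2) ℂ), (∀ X Y, γ (α X * β Y) = X * Y) → 9 ≤ Module.finrank ℂ ↥(LinearMap.range α * LinearMap.range β)

/-- item stmt-MatrixMultiplication-8736 · crux · rank 3 · open · by planner
why it might fail: (i) the 3k−4 theorem is proved for squares only (CouvreurZemor2024), pairs S ≠ T are open; (ii) needs rigidity for codimension-γ sub-pairs of progressions up to γ = n² − 3, far beyond Lemma A (γ = 0); at n = 3 it asserts cost ≥ 24 while R(⟨3,3,3⟩) ∈ [19, 23].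
sources: CouvreurZemor2024, BachocCouvreurZemor2018, arXiv:2405.10724, Landsberg2014, MassarentiRaviolo2013, Blaser2003
[crux] For every n ≥ 2 every polynomial hosting of ⟨n,n,n⟩ costs at least 3n² − 3, i.e. the whole
Freiman window dim V₁V₂ ≤ dim V₁ + dim V₂ + n² − 4 contains no hosting (card K2): (i) a PAIR version
inside ℂ(t) of the function-field 3k−4 theorem (CouvreurZemor2024 Thm 1 is the square case:
combinatorial genus γ ≤ dim S − 3 forces transcendence degree 1, genus g ≤ γ and S of codimension ≤
γ − g in a Riemann–Roch space; inside ℂ(t) every subfield is rational, g = 0) placing V₁, V₂ in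
dilated progressions y_i·Prog(u) with total codimension ≤ γ; (ii) HANKEL RIGIDITY: sub-pairs of
(Prog_a(u), Prog_b(u)) with a + b − 1 ≤ 3n² − 4 host no ⟨n,n,n⟩ (the card's Lemma A is n = 2, a = b
= 4, γ = 0). Through UpperSandwich it only returns R ≥ 1.5n²; its value is to validate tools
(i)–(ii) where the inverse theorem is printed. [deps: TwoByTwoHostingNine] [difficulty: L] -/
@[route_item "route-MatrixMultiplication-FieldSumsetRank"]
def ThreeKMinusFourRung : Prop :=
  ∀ n : ℕ, 2 ≤ n → ∀ (α β : Matrix (Fin n) (Fin n) ℂ →ₗ[ℂ] Polynomial ℂ) (γ : Polynomial ℂ →ₗ[ℂ] Matrix (Fin n) (Fin n) ℂ), (∀ X Y, γ (α X * β Y) = X * Y) → 3 * n ^ 2 - 3 ≤ Module.finrank ℂ ↥(LinearMap.range α * LinearMap.range β)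

/-- item stmt-MatrixMultiplication-8737 · crux · rank 4 · open · by planner
why it might fail: No inverse theorem at doubling ≥ 3 exists in any field extension (CouvreurZemor2024 stops at 3k−4), and hosts of transcendence degree 2 (products of progressions, doubling 4) appear; false iff cost < (6+o(1))n² infinitely often, which forces R(⟨n,n,n⟩) < (6+o(1))n² i.o. — open either way.
sources: Landsberg2014, MassarentiRaviolo2013, CouvreurZemor2024, EfremenkoGargOliveiraWigderson2018, Buczynski2026
[crux] There is c > 6 such that for all large n every polynomial hosting of ⟨n,n,n⟩ costs at least
c·n². With UpperSandwich (cost ≤ 2R − 1) this gives R(⟨n,n,n⟩) > (c/2)·n² > 3n² eventually, i.e.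
FBeatThreeNSquared of route BorderRankLowerBound (stmt-0654): the first statement of the new
language that beats the 3n² − o(n²) record. It lives at constant doubling ≤ 6 — the regime of
Freiman's theorem over ℤ — and asks for a function-field Freiman theorem (structure of
n²-dimensional pairs with dim V₁V₂ < 6n²) plus rigidity of the structured pairs. [deps:
ThreeKMinusFourRung] [difficulty: open-problem] -/
@[route_item "route-MatrixMultiplication-FieldSumsetRank"]
def HostingBeatsSix : Prop :=
  ∃ c : ℝ, 6 < c ∧ ∀ᶠ n : ℕ in Filter.atTop, ∀ (α β : Matrix (Fin n) (Fin n) ℂ →ₗ[ℂ] Polynomial ℂ) (γ : Polynomial ℂ →ₗ[ℂ] Matrix (Fin n) (Fin n) ℂ), (∀ X Y, γ (α X * β Y) = X * Y) → c * (n : ℝ) ^ 2 ≤ (Module.finrank ℂ ↥(LinearMap.range α * LinearMap.range β) : ℝ)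

/-- item stmt-MatrixMultiplication-8738 · support · rank 9 · closed · proved by Summit.MatrixMultiplication.MatrixMultiplication.Theorems.upperSandwich_proof @ 4fa1f66ab806 (prover) · by planner
sources: Blaser2013, BurgisserClausenShokrollahi1997
[support] If R(⟨n,n,n⟩) ≤ r then ⟨n,n,n⟩ has a polynomial hosting of cost ≤ 2r − 1: from XY =
Σ_{i≤r} a_i(X) b_i(Y) C_i (unpack tensorRank as a sum of r triads, Nat.sInf_mem) take r distinct
nodes t_i with Lagrange basis ℓ_i of ℂ[t]_{<r}, α(X) = Σ a_i(X)ℓ_i, β(Y) = Σ b_i(Y)ℓ_i, γ = Σ_i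
C_i·ev_{t_i}; then γ(α(X)β(Y)) = XY and range α · range β ⊆ ℂ[t]_{≤2r−2} (Polynomial.degreeLT); r =
0 forces n = 0 or is vacuous. [difficulty: provable-now] -/
@[route_item "route-MatrixMultiplication-FieldSumsetRank", crux]
def UpperSandwich : Prop :=
  ∀ n r : ℕ, Literature.Computability.AlgebraicComplexity.tensorRank (Literature.Computability.AlgebraicComplexity.matMulTensor ℂ n n n) ≤ r → ∃ (α β : Matrix (Fin n) (Fin n) ℂ →ₗ[ℂ] Polynomial ℂ) (γ : Polynomial ℂ →ₗ[ℂ] Matrix (Fin n) (Fin n) ℂ), (∀ X Y, γ (α X * β Y) = X * Y) ∧ Module.finrank ℂ ↥(LinearMap.range α * LinearMap.range β) ≤ 2 * r - 1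

/-- item stmt-MatrixMultiplication-8739 · support · rank 9 · closed · proved by Summit.MatrixMultiplication.MatrixMultiplication.Theorems.lowerSandwich_proof @ 8d459de24e97 (prover) · by planner
sources: Blaser2013, BurgisserClausenShokrollahi1997, BrockettDobkin1978
[support] A polynomial hosting of cost p yields a rank-p bilinear algorithm, so R(⟨n,n,n⟩) ≤
dim(range α · range β): choose p nodes on which the p-dimensional space W = V₁V₂ ⊂ ℂ[t] is
interpolating (evaluation functionals span W^*, pick a basis), write w = Σ_k w(t_k) ω_k on W, and
read XY = γ(α(X)β(Y)) = Σ_k α(X)(t_k)·β(Y)(t_k)·γ(ω_k) as p triads (tensorRank_le_of_eq_sum).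
[difficulty: provable-now] -/
@[route_item "route-MatrixMultiplication-FieldSumsetRank"]
def LowerSandwich : Prop :=
  ∀ (n : ℕ) (α β : Matrix (Fin n) (Fin n) ℂ →ₗ[ℂ] Polynomial ℂ) (γ : Polynomial ℂ →ₗ[ℂ] Matrix (Fin n) (Fin n) ℂ), (∀ X Y, γ (α X * β Y) = X * Y) → Literature.Computability.AlgebraicComplexity.tensorRank (Literature.Computability.AlgebraicComplexity.matMulTensor ℂ n n n) ≤ Module.finrank ℂ ↥(LinearMap.range α * LinearMap.range β)

/-- item stmt-MatrixMultiplication-8740 · support · rank 9 · closed · proved by Summit.MatrixMultiplication.MatrixMultiplication.Theorems.strassenHostingEleven_proof @ 045c7b513df3 (prover) · by planner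
sources: DeGroote1978, Blaser2013, HopcroftKerr1971
[support] ⟨2,2,2⟩ has a polynomial hosting of cost ≤ 11 (so cost(2) ≤ 11 < 13 = 2R − 1): with
Strassen's algorithm XY = Σ_{i≤7} a_i(X) b_i(Y) C_i (a = (x11+x22, x21+x22, x11, x22, x11+x12,
x21−x11, x12−x22), b = (y11+y22, y11, y12−y22, y21−y11, y22, y11+y12, y21+y22), C = (E11+E22,
E21−E22, E12+E22, E11+E21, E12−E11, E22, E11)), the nowhere-zero dependencies u =
(1,1,−3,−3,1,−1,−1) (Σ u_i a_i = 0) and u' = (1,1,1,1,1,−1,−1) (Σ u'_i b_i = 0), seven distinct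
nodes t_i, w_i = Π_{j≠i}(t_i − t_j)^{-1}, y_i = u_i/w_i, z_i = u'_i/w_i: α(X) = the unique
polynomial of degree ≤ 5 interpolating (t_i, y_i a_i(X)) (the seven conditions are consistent
because (w_i y_i) annihilates A), β(Y) likewise from (t_i, z_i b_i(Y)), γ = Σ_i (y_i z_i)^{-1}
C_i·ev_{t_i}; then γ(α(X)β(Y)) = XY and range α · range β ⊆ ℂ[t]_{≤10}. [difficulty: provable-now] -/
@[route_item "route-MatrixMultiplication-FieldSumsetRank"]
def StrassenHostingEleven : Prop :=
  ∃ (α β : Matrix (Fin 2) (Fin 2) ℂ →ₗ[ℂ] Polynomial ℂ) (γ : Polynomial ℂ →ₗ[ℂ] Matrix (Fin 2) (Fin 2) ℂ), (∀ X Y, γ (α X * β Y) = X * Y) ∧ Module.finrank ℂ ↥(LinearMap.range α * LinearMap.range β) ≤ 11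

/-- item stmt-MatrixMultiplication-8741 · support · rank 9 · closed · proved by Summit.MatrixMultiplication.MatrixMultiplication.Theorems.TwoByTwoHosting.twoByTwoHostingEight_proof @ 7d74cfba610d (prover) · by planner
sources: BachocSerraZemor2017, BachocSerraZemor2018Kneser, BachocCouvreurZemor2018, IarrobinoKanev1999, HopcroftKerr1971
[support] Every polynomial hosting of ⟨2,2,2⟩ costs at least 8 (card Lemma A + pair-Vosper): α, β
are injective, Kneser's theorem for the extension ℂ(t)/ℂ gives dim V₁V₂ ≥ 4 + 4 − 1 (ℂ is
algebraically closed in ℂ(t), so the stabiliser field of V₁V₂ is ℂ), the Vosper analogue makes a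
cost-7 pair a pair of dilated progressions y₁·Prog₄(u), y₂·Prog₄(u), i.e. the host map is 4×4 → 7
polynomial multiplication, and Lemma A excludes it: the pencil Z = e₁wᵀ gives a projective line of
rank-2 bilinear forms (X,Y) ↦ tr(ZXY) with no rank-1 point, whereas 4×4 Hankel forms of rank ≤ 2
form the cone over σ₂ of the rational normal sextic and every line in σ₂(C₆) meets C₆ (any 7 points
of C₆ are independent). [difficulty: M] -/
@[route_item "route-MatrixMultiplication-FieldSumsetRank"]
def TwoByTwoHostingEight : Prop :=
  ∀ (α β : Matrix (Fin 2) (Fin 2) ℂ →ₗ[ℂ] Polynomial ℂ) (γ : Polynomial ℂ →ₗ[ℂ] Matrix (Fin 2) (Fin 2) ℂ), (∀ X Y, γ (α X * β Y) = X * Y) → 8 ≤ Module.finrank ℂ ↥(LinearMap.range α * LinearMap.range β)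

-- earlier Assembly (stmt-MatrixMultiplication-8742, replaced 2026-08-15T16:36:40Z -> stmt-MatrixMultiplication-11007): retired by None — HostingSuperquadratic → UpperSandwich → ¬ MatrixMultiplication
/-- item stmt-MatrixMultiplication-11007 · assembly · rank 1 · closed · proved by Summit.MatrixMultiplication.MatrixMultiplication.Theorems.fieldSumsetRank_assembly_proof @ 00a8cdd78641 (prover) · by planner
sources: Blaser2013, Landsberg2014
[assembly] HostingSuperquadratic → UpperSandwich → ¬ MatrixMultiplication (negative side: the summit
ω(ℂ) = 2 is refuted); identical to the deciding theorem `closes` (D-0027 §2.1), summit constant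
fully qualified. -/
@[route_item "route-MatrixMultiplication-FieldSumsetRank"]
def Assembly : Prop :=
  HostingSuperquadratic → UpperSandwich → ¬ _root_.MatrixMultiplication

/-! D-0027 §2.1 — DECIDING THEOREM (planner-authored via `route open/edit --closes-file`; by planner-rrepair-MatrixMultiplication-FieldSums-3ef2757d-g2-0 2026-08-15T16:36:40Z):
its hypotheses are this route's items and its conclusion the sub-problem Statement (glue_lint), and it elaborates with this file. -/

/-- Route glue (D-0027 §2.1, refutation line): the target `HostingSuperquadratic` and the support
item `UpperSandwich` refute the summit `ω(ℂ) = 2`: a rank-`R` algorithm interpolated at `R` nodes is a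
polynomial hosting of cost `≤ 2R − 1`, so the superquadratic cost bound gives
`R(⟨n,n,n⟩) ≥ (c/2)·n^{2+δ}` for all `n ≥ 1`, the hypothesis of the proved assembly of route
BorderRankLowerBound (`Literature.not_matrixMultiplication_of_superquadratic_rank`). -/
@[closes "route-MatrixMultiplication-FieldSumsetRank"] theorem closes : HostingSuperquadratic → UpperSandwich → ¬ MatrixMultiplication := by
  rintro ⟨δ, hδ, c, hc, hX⟩ hU
  refine Literature.not_matrixMultiplication_of_superquadratic_rank ⟨δ, hδ, c / 2, by positivity, ?_⟩
  intro n hn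
  obtain ⟨α, β, γ, hhost, hdim⟩ := hU n _ le_rfl
  have h1 := hX n hn α β γ hhost
  have h2 : (Module.finrank ℂ ↥(LinearMap.range α * LinearMap.range β) : ℝ)
      ≤ 2 * (Literature.Computability.AlgebraicComplexity.tensorRank
        (Literature.Computability.AlgebraicComplexity.matMulTensor ℂ n n n) : ℝ) := by
    have h3 : Module.finrank ℂ ↥(LinearMap.range α * LinearMap.range β)
        ≤ 2 * Literature.Computability.AlgebraicComplexity.tensorRank
          (Literature.Computability.AlgebraicComplexity.matMulTensor ℂ n n n) :=
      hdim.trans (Nat.sub_le _ _)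
    exact_mod_cast h3
  calc c / 2 * (n : ℝ) ^ (2 + δ) = (c * (n : ℝ) ^ (2 + δ)) / 2 := by ring
    _ ≤ (Module.finrank ℂ ↥(LinearMap.range α * LinearMap.range β) : ℝ) / 2 := by gcongr
    _ ≤ _ := by linarith

end Summit.MatrixMultiplication.MatrixMultiplication.Theses.FieldSumsetRank
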